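import Literature.Geometry.Kaehler.ComplexTorusAndreTransposePositivity
import Literature.Geometry.Kaehler.ComplexTorusCorrespondenceAction
import Literature.Geometry.Kaehler.ComplexTorusWeilOperatorWeylOperator
import HarnessLib

/-!
# André's adjoint `u ↦ u′ = *_H ᵗu *_H` is an ANTI-INVOLUTION of the algebra of real operators on `H•(X; ℂ)` commuting with the Weil operator:
# `ᵗ(e^{iθ})^* = (e^{−iθ})^*`, transposes of `C`-commuting operators are two-sided and commute with `C`, `u″ = u`, `(uv)′ = v′u′`,
# `Tr ᵗu = Tr u′ = Tr u`, and the trace form `(u, v) ↦ Tr(u v′)` is SYMMETRIC and REAL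

Layer `Literature/Geometry/Kaehler`, namespace `Literature.Geometry.Kaehler.ComplexTorus`; lane `lit-hodgefound` (Track 2 foundations library),
prover seat `lit-hodgefound-p35` (generation 52, row g52-#3; sequel of rows g52-#1 `ComplexTorusAndreHodgeMetric` (the Hodge metric `⟨ , ⟩_H`), g52-#2
`ComplexTorusAndreTransposePositivity` (`u′` is the `⟨ , ⟩_H`-adjoint of `u`; `Tr(u u′) > 0`), g51-#1 `ComplexTorusGradedPoincarePairing` (`B_e`, graded symmetry,
`*_H` self-adjoint) and of skel-4's `ComplexTorusCorrespondenceAction` (`torusIntegral_compContinuousLinearMap_rotateCLM`: top forms are rotation invariant)).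
THEOREMS ONLY (no definition, no named fact, no instance, no notation; D-0026 net debt `0`).

THE POINT. André (Prop. 3.3) calls `(u, v) ↦ Tr_{H(X)}(u *_H ᵗv *_H)` "la forme bilinéaire SYMÉTRIQUE" on the algebra `C⁰_mot(X, X)` of degree-`0` motivated
correspondences, stable under `u ↦ ᵗu` (Prop. 2.3: "stable par transposition") and under `u ↦ *_H ᵗu *_H`; the positivity of `Tr(u u′)` was row g52-#2. THIS FILE
supplies the involution algebra behind "symétrique" for the algebra of ALL real operators on `H•(X; ℂ)` commuting with the Weil operator `C` (the endomorphisms of the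
real Hodge structure): (§1) the circle action is an isometry of the Poincaré pairing (`B_e((e^{iθ})^* w, (e^{iθ})^* w') = B_e(w, w')`, so `ᵗC = C⁻¹ = C³`); (§2) the graded
symmetry of `B_e` reads `B_e(w, w') = B_e(ε w', w)` with the parity operator `ε = (e^{iπ})^* = C²`; (§3) hence the right transpose of an operator commuting with `ε` — in
particular of one commuting with `C` — is also its left transpose (`ᵗᵗu = u`), and (§4) the transpose of a `C`-commuting operator commutes with `C`; (§5) `u′ = *_H ᵗu *_H`
is again real and `C`-commuting, `ᵗ(u′) = *_H u *_H`, `u″ = u`, `(uv)′ = v′ u′`; (§6) `Tr ᵗu = Tr u` (conjugation by `B_e.toDual` carries `u` to the dual map of `ᵗu`),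
`Tr u′ = Tr u`, the trace form is symmetric `Tr(u v′) = Tr(v u′)`, `\overline{Tr(u v′)} = Tr(v u′)` (adjunction for `⟨ , ⟩_H`), hence `Tr(u v′) ∈ ℝ`.

## What is proved (`B = poincarePairingG Φ e`, `C = rotG E (π/2)`, `ε = rotG E π`, `*_H = (hasLefschetzProperty_lefschetzG hη).andreHodgeInvolution isZGrading_countingG (finrank ℂ E)`;
"`ᵗu`" means a right Poincaré transpose: `LinearMap.IsAdjointPair B B u ut`, i.e. `B(u x, y) = B(x, ut y)`)

* §1 **`poincarePairingG_rotG_rotG`** (`B((e^{iθ})^* w, (e^{iθ})^* w') = B(w, w')`), **`isAdjointPair_poincarePairingG_rotG`** (`ᵗ(e^{iθ})^* = (e^{−iθ})^*`),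
  `isAdjointPair_poincarePairingG_rotG_pi_div_two` (`ᵗC = C³`).
* §2 `rotG_pi_of` (`ε (of k x) = (−1)ᵏ of k x`), **`poincarePairingG_eq_rotG_pi_comm`** (`B(w, w') = B(ε w', w)`), `commute_rotG_pi_of_commute_rotG_pi_div_two` (`[C, u] = 0 ⇒ [ε, u] = 0`).
* §3 **`isAdjointPair_comm_of_commute_rotG_pi`** (`B(u x, y) = B(x, ᵗu y)` and `[ε, u] = 0` ⇒ `B(ᵗu x, y) = B(x, u y)`), `isAdjointPair_comm_of_commute_rotG_pi_div_two`.
* §4 **`commute_rotG_pi_div_two_of_isAdjointPair`** (`[C, u] = 0 ⇒ [C, ᵗu] = 0`).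
* §5 `isAdjointPair_poincarePairingG_andreAdjoint` (`ᵗ(*_H ᵗu *_H) = *_H u *_H`), **`andreAdjoint_andreAdjoint`** (`u″ = u`), `andreAdjoint_mul` (`*_H ᵗ(uv) *_H = v′ u′` for
  `ᵗ(uv) = ᵗv ᵗu`, `IsAdjointPair.mul`), `conjG_andreAdjoint_apply` (`u′` is real), `commute_rotG_pi_div_two_andreAdjoint` (`[C, u′] = 0`).
* §6 **`trace_eq_of_isAdjointPair_poincarePairingG`** (`Tr ᵗu = Tr u`), **`trace_andreAdjoint`** (`Tr u′ = Tr u`), **`trace_mul_andreAdjoint_comm`** (`Tr(u v′) = Tr(v u′)`),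
  `conj_trace_mul_andreAdjoint` (`\overline{Tr(u v′)} = Tr(v u′)`, Kähler datum), **`conj_trace_mul_andreAdjoint_self`** (`Tr(u v′) ∈ ℝ`).

## Sources, VERBATIM

* Y. André, *Pour une théorie inconditionnelle des motifs*, Publ. Math. IHÉS **83** (1996) [Andre1996Motifs], held `paper:doi-10-1007-bf02698643`: §1.1 (p. 11 = chunk p0008
  L12–L14) "Remarquons aussi que `L`, `*_L`, `*_H` et `ᶜΛ` sont auto-adjoints relativement à l'accouplement de dualité de Poincaré `(x, y) ↦ ∫ x ∪ y`"; Prop. 2.3 (p. 16)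
  "stable par transposition"; Prop. 3.3 (p. 21 = chunk p0018 L33–L38) "la forme bilinéaire symétrique sur `C⁰_mot(X, X)` donnée par `(u, v) ↦ Tr_{H(X)}(u *_H ᵗv *_H)` est à
  valeurs dans `ℚ`, et définie positive".
* S. L. Kleiman, *Algebraic cycles and the Weil conjectures* (1968) [Kleiman1968AlgebraicCycles], §3 Thm. 3.11 (the involution `u ↦ u'`; cited through André).
* C. Voisin, *Hodge Theory and Complex Algebraic Geometry I* (2002) [VoisinHodgeI2002], §7.3.2 proof of Lemma 7.30 (a top-degree form has type `(n, n)`: rotation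
  invariance of `∫_X`), §2.3.1 (the `U(1)`-action on forms).
* H. Lange, *Abelian Varieties over the Complex Numbers* (2023) [Lange2023AbelianVarietiesComplex], §1.1.3 Lemma 1.1.17 (b) (graded commutativity of the cup product),
  §1.1.3 Cor. 1.1.19 (traces of endomorphisms on `H•`).
* N. Bourbaki, *Algebra I* (Springer 1989) [BourbakiAlgebraI1989], Ch. II §4 no. 3 and Ch. III §9 (the transpose `ᵗu` with respect to a non-degenerate bilinear form satisfies
  `Tr ᵗu = Tr u`; `ᵗ(uv) = ᵗv ᵗu`).

## Scope / not here

The consequences for nil ideals and semisimplicity (André Prop. 3.1/3.3 via Jannsen's argument) are the next row; rationality of the traces is not treated.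
-/

noncomputable section

namespace Literature.Geometry.Kaehler

namespace ComplexTorus

open Module Function Finset
open Literature.LinearAlgebra.Alternating Literature.Algebra.Lie Literature.Analysis.Complex

set_option maxSynthPendingDepth 3

universe uE

variable {ι : Type*} [Fintype ι] [DecidableEq ι] {E : Type uE} [NormedAddCommGroup E] [NormedSpace ℂ E] [FiniteDimensional ℂ E]
  [Nontrivial E] (Φ : (ι → ℝ) ≃L[ℝ] E) {η : E [⋀^Fin 2]→L[ℝ] ℝ} (hη : ∀ v : E, v ≠ 0 → ∃ w : E, η ![v, w] ≠ 0) {N : ℕ}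

/-! ## §0 Toolkit -/

section Toolkit

omit [Fintype ι] [DecidableEq ι] [NormedAddCommGroup E] [NormedSpace ℂ E] [FiniteDimensional ℂ E] [Nontrivial E] in
/-- **`\overline{Tr A} = Tr A*`** for the adjoint `A*` of `A` with respect to a positive definite Hermitian form on a finite-dimensional complex space (`⟨A* x, y⟩ = ⟨x, A y⟩`):
`Tr A = Σᵢ ⟨bᵢ, A bᵢ⟩` in an orthonormal basis and `\overline{⟨bᵢ, A bᵢ⟩} = ⟨A bᵢ, bᵢ⟩ = ⟨bᵢ, A* bᵢ⟩`. [cite: HornJohnson2013, §1.2 / (0.2.5) (`tr A* = \overline{tr A}`)] -/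
private theorem conj_trace_eq_trace_of_adjoint₅₆ {V : Type*} [AddCommGroup V] [Module ℂ V] [FiniteDimensional ℂ V] (cV : InnerProductSpace.Core ℂ V)
    {A As : Module.End ℂ V} (hA : ∀ x y, cV.inner (As x) y = cV.inner x (A y)) :
    starRingEnd ℂ (LinearMap.trace ℂ V A) = LinearMap.trace ℂ V As := by
  letI : InnerProductSpace.Core ℂ V := cV
  letI : NormedAddCommGroup V := @InnerProductSpace.Core.toNormedAddCommGroup ℂ V _ _ _ cV
  letI : InnerProductSpace ℂ V := InnerProductSpace.ofCore cV.toCore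
  have hA' : ∀ x y : V, inner ℂ (As x) y = inner ℂ x (A y) := hA
  let b := stdOrthonormalBasis ℂ V
  rw [LinearMap.trace_eq_sum_inner A b, LinearMap.trace_eq_sum_inner As b, map_sum]
  refine Finset.sum_congr rfl fun i _ ↦ ?_
  rw [inner_conj_symm, ← inner_conj_symm (b i) (As (b i)), hA', inner_conj_symm]

end Toolkit

/-! ## §1 The circle action is an isometry of the Poincaré pairing; `ᵗC = C⁻¹` -/

section Isometry

omit [FiniteDimensional ℂ E] [Nontrivial E] in
/-- **`B_e((e^{iθ})^* w, (e^{iθ})^* w') = B_e(w, w')`**: the Hodge circle action — in particular the Weil operator `C = (e^{iπ/2})^*` — is an ISOMETRY of the graded Poincaré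
pairing (`(e^{iθ})^*` is multiplicative for the wedge product and fixes top-degree forms, which have type `(g, g)`: `∫_X (Θ ∘ e^{iθ}) = ∫_X Θ`).
[cite: VoisinHodgeI2002, §7.3.2 (proof of Lemma 7.30) and §2.3.1] [cite: Andre1996Motifs, §1.1 (p. 11)] -/
theorem poincarePairingG_rotG_rotG (e : Fin N ≃ ι) (θ : ℝ) (w w' : GForm E ℂ) :
    poincarePairingG Φ e (rotG E θ w) (rotG E θ w') = poincarePairingG Φ e w w' := by
  rw [poincarePairingG_apply, poincarePairingG_apply]
  refine Finset.sum_congr rfl fun k _ ↦ ?_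
  rw [poincarePairing_eq_orientationSign_mul_torusIntegral_wedge, poincarePairing_eq_orientationSign_mul_torusIntegral_wedge]
  congr 1
  change torusIntegral Φ _ (((w k).compContinuousLinearMap (rotateCLM θ)).wedge ((w' (N - k)).compContinuousLinearMap (rotateCLM θ))) = _
  rw [← ContinuousAlternatingMap.wedge_compContinuousLinearMap, torusIntegral_compContinuousLinearMap_rotateCLM]

omit [FiniteDimensional ℂ E] [Nontrivial E] in
/-- **`ᵗ(e^{iθ})^* = (e^{−iθ})^*`: `B_e((e^{iθ})^* x, y) = B_e(x, (e^{−iθ})^* y)`** (isometry and `(e^{iθ})^* (e^{−iθ})^* = 1`). [cite: VoisinHodgeI2002, §2.3.1]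
[cite: Andre1996Motifs, §1.1 (p. 11)] -/
theorem isAdjointPair_poincarePairingG_rotG (e : Fin N ≃ ι) (θ : ℝ) :
    LinearMap.IsAdjointPair (poincarePairingG Φ e) (poincarePairingG Φ e) (rotG E θ) (rotG E (-θ)) := fun x y ↦ by
  conv_lhs => rw [show y = rotG E θ (rotG E (-θ) y) from (LinearMap.congr_fun (rotG_self_mul_neg (E := E) θ) y).symm, poincarePairingG_rotG_rotG]

omit [FiniteDimensional ℂ E] [Nontrivial E] in
/-- **`ᵗC = C³ (= C⁻¹)`**: `B_e(C x, y) = B_e(x, C³ y)` for the Weil operator `C = (e^{iπ/2})^*` (`C³ = (e^{−iπ/2})^*`). [cite: VoisinHodgeI2002, §2.3.1]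
[cite: DeligneHodgeII1971, Déf. 2.1.15] -/
theorem isAdjointPair_poincarePairingG_rotG_pi_div_two (e : Fin N ≃ ι) :
    LinearMap.IsAdjointPair (poincarePairingG Φ e) (poincarePairingG Φ e) (rotG E (Real.pi / 2)) ⇑(rotG E (Real.pi / 2) ^ 3) := by
  rw [rotG_pi_div_two_pow_three]
  exact isAdjointPair_poincarePairingG_rotG Φ e _

end Isometry

/-! ## §2 The parity operator `ε = (e^{iπ})^* = C²` and the graded symmetry of `B_e` -/

section Parity

omit [FiniteDimensional ℂ E] [Nontrivial E] in
/-- **`ε (of k x) = (−1)ᵏ · of k x`** for the parity operator `ε = (e^{iπ})^*` (`(−1)^* = (−1)ᵏ` on `k`-forms). [cite: VoisinHodgeI2002, §2.3.1]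
[cite: Deligne1982HodgeCycles, I Prop. 3.6 (proof: "`C²` acts as `(−1)ⁿ`")] -/
theorem rotG_pi_of (k : ℕ) (x : E [⋀^Fin k]→L[ℝ] ℂ) : rotG E Real.pi (GForm.of k x) = ((-1 : ℂ) ^ k) • GForm.of k x := by
  funext m
  rw [rotG_pi_apply, Pi.smul_apply]
  rcases eq_or_ne m k with rfl | h
  · rfl
  · rw [GForm.of_apply_of_ne h, smul_zero, smul_zero]

omit [Nontrivial E] in
/-- **GRADED SYMMETRY VIA THE PARITY OPERATOR: `B_e(w, w') = B_e(ε w', w)`**, `ε = (e^{iπ})^*` (`B_e(w, of k x) = (−1)ᵏ B_e(of k x, w)` of row g51-#1, summed over the degrees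
of `w'`). [cite: Lange2023AbelianVarietiesComplex, §1.1.3 Lemma 1.1.17 (b)] [cite: Andre1996Motifs, §1.1 (p. 11)] -/
theorem poincarePairingG_eq_rotG_pi_comm (e : Fin N ≃ ι) (w w' : GForm E ℂ) :
    poincarePairingG Φ e w w' = poincarePairingG Φ e (rotG E Real.pi w') w := by
  conv_lhs => rw [← sum_range_of_eq w']
  conv_rhs => rw [← sum_range_of_eq w']
  rw [map_sum (poincarePairingG Φ e w), map_sum (rotG E Real.pi), map_sum (poincarePairingG Φ e), LinearMap.sum_apply]
  refine Finset.sum_congr rfl fun k _ ↦ ?_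
  rw [poincarePairingG_apply_of_comm, rotG_pi_of, map_smul, LinearMap.smul_apply, smul_eq_mul]

omit [FiniteDimensional ℂ E] [Nontrivial E] in
/-- **`[C, u] = 0 ⇒ [ε, u] = 0`** (`ε = C²`). [cite: Deligne1982HodgeCycles, I Prop. 3.6 (proof)] -/
theorem commute_rotG_pi_of_commute_rotG_pi_div_two {T : Module.End ℂ (GForm E ℂ)} (hC : Commute (rotG E (Real.pi / 2)) T) : Commute (rotG E Real.pi) T := by
  rw [← rotG_pi_div_two_mul_self]
  exact hC.mul_left hC

end Parity

/-! ## §3 Transposes of operators commuting with `ε` are two-sided -/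

section TwoSided

omit [Nontrivial E] in
/-- **A right Poincaré transpose of an operator commuting with the parity operator is also its left transpose**: from `B_e(u x, y) = B_e(x, ᵗu y)` and `[ε, u] = 0`,
`B_e(ᵗu x, y) = B_e(ε y, ᵗu x) = B_e(u ε y, x) = B_e(ε u y, x) = B_e(x, u y)`. So `ᵗᵗu = u` for such `u` (degree-preserving operators, operators commuting with `C`, …):
the transposition of André's Prop. 2.3/3.3 is an involution. [cite: Andre1996Motifs, §1.1 (p. 11), Prop. 2.3] [cite: BourbakiAlgebraI1989, Ch. III §9 / Ch. II §4 no. 3] -/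
theorem isAdjointPair_comm_of_commute_rotG_pi (e : Fin N ≃ ι) {T Tt : Module.End ℂ (GForm E ℂ)}
    (hadj : LinearMap.IsAdjointPair (poincarePairingG Φ e) (poincarePairingG Φ e) T Tt) (hε : Commute (rotG E Real.pi) T) :
    LinearMap.IsAdjointPair (poincarePairingG Φ e) (poincarePairingG Φ e) Tt T := fun x y ↦ by
  have h1 : T (rotG E Real.pi y) = rotG E Real.pi (T y) := (LinearMap.congr_fun hε.eq y).symm
  rw [poincarePairingG_eq_rotG_pi_comm Φ e (Tt x) y, ← hadj, h1, ← poincarePairingG_eq_rotG_pi_comm]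

omit [Nontrivial E] in
/-- **Transposes of operators commuting with the Weil operator are two-sided**: `B_e(u x, y) = B_e(x, ᵗu y)` and `[C, u] = 0` give `B_e(ᵗu x, y) = B_e(x, u y)`.
[cite: Andre1996Motifs, Prop. 2.3, Prop. 3.3 (p. 21)] [cite: BourbakiAlgebraI1989, Ch. III §9] -/
theorem isAdjointPair_comm_of_commute_rotG_pi_div_two (e : Fin N ≃ ι) {T Tt : Module.End ℂ (GForm E ℂ)}
    (hadj : LinearMap.IsAdjointPair (poincarePairingG Φ e) (poincarePairingG Φ e) T Tt) (hC : Commute (rotG E (Real.pi / 2)) T) :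
    LinearMap.IsAdjointPair (poincarePairingG Φ e) (poincarePairingG Φ e) Tt T :=
  isAdjointPair_comm_of_commute_rotG_pi Φ e hadj (commute_rotG_pi_of_commute_rotG_pi_div_two hC)

end TwoSided

/-! ## §4 Transposes of `C`-commuting operators commute with `C` -/

section CommuteTranspose

omit [Nontrivial E] in
/-- **`[C, u] = 0 ⇒ [C, ᵗu] = 0`**: `B_e(x, ᵗu C y) = B_e(u x, C y) = B_e(C⁻¹ u x, y) = B_e(u C⁻¹ x, y) = B_e(C⁻¹ x, ᵗu y) = B_e(x, C ᵗu y)` (`C` a `B_e`-isometry, §1), and `B_e` is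
non-degenerate. So the algebra of operators commuting with the Weil operator is "stable par transposition". [cite: Andre1996Motifs, Prop. 2.3, §1.1 (p. 11)]
[cite: VoisinHodgeI2002, §2.3.1] -/
theorem commute_rotG_pi_div_two_of_isAdjointPair (e : Fin N ≃ ι) {T Tt : Module.End ℂ (GForm E ℂ)}
    (hadj : LinearMap.IsAdjointPair (poincarePairingG Φ e) (poincarePairingG Φ e) T Tt) (hC : Commute (rotG E (Real.pi / 2)) T) :
    Commute (rotG E (Real.pi / 2)) Tt := by
  obtain ⟨-, hr⟩ := poincarePairingG_nondegenerate Φ e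
  have hC3 : Commute (rotG E (-(Real.pi / 2))) T := by rw [← rotG_pi_div_two_pow_three]; exact hC.pow_left 3
  have hrot := isAdjointPair_poincarePairingG_rotG Φ e (-(Real.pi / 2))
  rw [neg_neg] at hrot
  refine LinearMap.ext fun y ↦ ?_
  rw [Module.End.mul_apply, Module.End.mul_apply, ← sub_eq_zero]
  refine hr _ fun x ↦ ?_
  rw [map_sub, sub_eq_zero, ← hrot, ← hadj, ← hadj, show T (rotG E (-(Real.pi / 2)) x) = rotG E (-(Real.pi / 2)) (T x) from
    (LinearMap.congr_fun hC3.eq x).symm, hrot]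

end CommuteTranspose

/-! ## §5 `u ↦ u′ = *_H ᵗu *_H` is an anti-involution preserving reality and `C`-commutation -/

section Involution

/-- **`ᵗ(u′) = *_H u *_H` for `u′ = *_H ᵗu *_H`** (`u` commuting with `C`): `B_e(u′ x, y) = B_e(x, *_H u *_H y)` — `*_H` is self-adjoint (row g51-#1) and `ᵗu` is two-sided (§3).
[cite: Andre1996Motifs, §1.1 (p. 11: `*_H` auto-adjoint), Prop. 3.3 (p. 21)] -/
theorem isAdjointPair_poincarePairingG_andreAdjoint (e : Fin N ≃ ι) {T Tt : Module.End ℂ (GForm E ℂ)}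
    (hadj : LinearMap.IsAdjointPair (poincarePairingG Φ e) (poincarePairingG Φ e) T Tt) (hC : Commute (rotG E (Real.pi / 2)) T) :
    LinearMap.IsAdjointPair (poincarePairingG Φ e) (poincarePairingG Φ e)
      ⇑((hasLefschetzProperty_lefschetzG hη).andreHodgeInvolution isZGrading_countingG (finrank ℂ E) * Tt *
        (hasLefschetzProperty_lefschetzG hη).andreHodgeInvolution isZGrading_countingG (finrank ℂ E))
      ⇑((hasLefschetzProperty_lefschetzG hη).andreHodgeInvolution isZGrading_countingG (finrank ℂ E) * T *
        (hasLefschetzProperty_lefschetzG hη).andreHodgeInvolution isZGrading_countingG (finrank ℂ E)) := by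
  have hs : LinearMap.IsAdjointPair (poincarePairingG Φ e) (poincarePairingG Φ e)
      ((hasLefschetzProperty_lefschetzG hη).andreHodgeInvolution isZGrading_countingG (finrank ℂ E))
      ((hasLefschetzProperty_lefschetzG hη).andreHodgeInvolution isZGrading_countingG (finrank ℂ E)) :=
    isSelfAdjoint_poincarePairingG_andreHodgeInvolution Φ hη e (finrank ℂ E)
  have h := (hs.mul (isAdjointPair_comm_of_commute_rotG_pi_div_two Φ e hadj hC)).mul hs
  rwa [← mul_assoc] at h

omit [Fintype ι] [DecidableEq ι] in
/-- **`u″ = u`: `*_H (*_H u *_H) *_H = u`** (`*_H² = 1`). With `ᵗ(u′) = *_H u *_H` (§5) this is `(u′)′ = u`: André's adjoint is an INVOLUTION.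
[cite: Andre1996Motifs, §1.1 (p. 10: "involutions de Lefschetz et de Hodge"), Prop. 3.3 (p. 21)] [cite: Kleiman1968AlgebraicCycles, §3 Thm. 3.11] -/
theorem andreAdjoint_andreAdjoint (hη : ∀ v : E, v ≠ 0 → ∃ w : E, η ![v, w] ≠ 0) (d : ℕ) (T : Module.End ℂ (GForm E ℂ)) :
    (hasLefschetzProperty_lefschetzG hη).andreHodgeInvolution isZGrading_countingG d *
        ((hasLefschetzProperty_lefschetzG hη).andreHodgeInvolution isZGrading_countingG d * T *
          (hasLefschetzProperty_lefschetzG hη).andreHodgeInvolution isZGrading_countingG d) *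
        (hasLefschetzProperty_lefschetzG hη).andreHodgeInvolution isZGrading_countingG d = T := by
  set s := (hasLefschetzProperty_lefschetzG hη).andreHodgeInvolution isZGrading_countingG d
  have hss : s * s = 1 := (hasLefschetzProperty_lefschetzG hη).andreHodgeInvolution_mul_self isZGrading_countingG d
  simp only [mul_assoc]
  rw [hss, mul_one, ← mul_assoc, hss, one_mul]

omit [Fintype ι] [DecidableEq ι] in
/-- **`(uv)′ = v′ u′`: `*_H (ᵗv ᵗu) *_H = (*_H ᵗv *_H)(*_H ᵗu *_H)`** (`ᵗ(uv) = ᵗv ᵗu` is Mathlib's `LinearMap.IsAdjointPair.mul`; `*_H² = 1`): André's adjoint is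
ANTI-MULTIPLICATIVE. [cite: Andre1996Motifs, Prop. 3.3 (p. 21)] [cite: BourbakiAlgebraI1989, Ch. III §9 (`ᵗ(uv) = ᵗv ᵗu`)] -/
theorem andreAdjoint_mul (hη : ∀ v : E, v ≠ 0 → ∃ w : E, η ![v, w] ≠ 0) (d : ℕ) (St Tt : Module.End ℂ (GForm E ℂ)) :
    (hasLefschetzProperty_lefschetzG hη).andreHodgeInvolution isZGrading_countingG d * (St * Tt) *
        (hasLefschetzProperty_lefschetzG hη).andreHodgeInvolution isZGrading_countingG d =
      (hasLefschetzProperty_lefschetzG hη).andreHodgeInvolution isZGrading_countingG d * St *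
          (hasLefschetzProperty_lefschetzG hη).andreHodgeInvolution isZGrading_countingG d *
        ((hasLefschetzProperty_lefschetzG hη).andreHodgeInvolution isZGrading_countingG d * Tt *
          (hasLefschetzProperty_lefschetzG hη).andreHodgeInvolution isZGrading_countingG d) := by
  set s := (hasLefschetzProperty_lefschetzG hη).andreHodgeInvolution isZGrading_countingG d
  have hss : s * s = 1 := (hasLefschetzProperty_lefschetzG hη).andreHodgeInvolution_mul_self isZGrading_countingG d
  simp only [mul_assoc]
  rw [← mul_assoc s s (Tt * s), hss, one_mul]

/-- **`u′ = *_H ᵗu *_H` is REAL for a real `u`** (`*_H` and `ᵗu` are real, row g52-#2). [cite: Andre1996Motifs, Prop. 3.3 (proof, p. 22)] -/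
theorem conjG_andreAdjoint_apply (e : Fin N ≃ ι) {T Tt : Module.End ℂ (GForm E ℂ)}
    (hadj : LinearMap.IsAdjointPair (poincarePairingG Φ e) (poincarePairingG Φ e) T Tt) (hT : ∀ x, GForm.conjG (T x) = T (GForm.conjG x)) (x : GForm E ℂ) :
    GForm.conjG (((hasLefschetzProperty_lefschetzG hη).andreHodgeInvolution isZGrading_countingG (finrank ℂ E) * Tt *
        (hasLefschetzProperty_lefschetzG hη).andreHodgeInvolution isZGrading_countingG (finrank ℂ E)) x) =
      ((hasLefschetzProperty_lefschetzG hη).andreHodgeInvolution isZGrading_countingG (finrank ℂ E) * Tt *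
        (hasLefschetzProperty_lefschetzG hη).andreHodgeInvolution isZGrading_countingG (finrank ℂ E)) (GForm.conjG x) := by
  rw [Module.End.mul_apply, Module.End.mul_apply, conjG_andreHodgeInvolution hη, conjG_apply_of_isAdjointPair_poincarePairingG Φ e hadj hT,
    conjG_andreHodgeInvolution hη, Module.End.mul_apply, Module.End.mul_apply]

/-- **`[C, u′] = 0` for `[C, u] = 0`** (`η` of type `(1,1)`): `C` commutes with `*_H` (row g52-#2) and with `ᵗu` (§4). So the algebra of real operators commuting with the
Weil operator is STABLE under André's adjoint. [cite: Andre1996Motifs, Prop. 2.3, Prop. 3.3 (p. 21)] [cite: Huybrechts2005, §1.2 Exercise 1.2.3] -/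
theorem commute_rotG_pi_div_two_andreAdjoint (h11 : ∀ u v : E, η ![Complex.I • u, Complex.I • v] = η ![u, v])
    (hη : ∀ v : E, v ≠ 0 → ∃ w : E, η ![v, w] ≠ 0) (e : Fin N ≃ ι) {T Tt : Module.End ℂ (GForm E ℂ)}
    (hadj : LinearMap.IsAdjointPair (poincarePairingG Φ e) (poincarePairingG Φ e) T Tt) (hC : Commute (rotG E (Real.pi / 2)) T) :
    Commute (rotG E (Real.pi / 2))
      ((hasLefschetzProperty_lefschetzG hη).andreHodgeInvolution isZGrading_countingG (finrank ℂ E) * Tt *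
        (hasLefschetzProperty_lefschetzG hη).andreHodgeInvolution isZGrading_countingG (finrank ℂ E)) :=
  ((commute_rotG_andreHodgeInvolution h11 hη _ _).mul_right (commute_rotG_pi_div_two_of_isAdjointPair Φ e hadj hC)).mul_right
    (commute_rotG_andreHodgeInvolution h11 hη _ _)

end Involution

/-! ## §6 Traces: `Tr ᵗu = Tr u′ = Tr u`; the trace form `Tr(u v′)` is symmetric and real -/

section Traces

omit [Nontrivial E] in
/-- **`Tr ᵗu = Tr u`** for a Poincaré transpose (`B_e(u x, y) = B_e(x, ᵗu y)`): conjugating `u` by the isomorphism `B_e.toDual : H•(X; ℂ) ≃ H•(X; ℂ)^*` gives the dual map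
of `ᵗu`, and dual maps and conjugates have the same trace. [cite: BourbakiAlgebraI1989, Ch. II §4 no. 3 (`Tr ᵗu = Tr u`)] [cite: Lange2023AbelianVarietiesComplex, §1.1.3 Cor. 1.1.19] -/
theorem trace_eq_of_isAdjointPair_poincarePairingG (e : Fin N ≃ ι) {T Tt : Module.End ℂ (GForm E ℂ)}
    (hadj : LinearMap.IsAdjointPair (poincarePairingG Φ e) (poincarePairingG Φ e) T Tt) :
    LinearMap.trace ℂ (GForm E ℂ) Tt = LinearMap.trace ℂ (GForm E ℂ) T := by
  have hB := poincarePairingG_nondegenerate Φ e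
  set D := (poincarePairingG Φ e).toDual hB with hD
  have hconj : D.conj T = Module.Dual.transpose (R := ℂ) Tt := by
    refine LinearMap.ext fun φ ↦ LinearMap.ext fun y ↦ ?_
    rw [LinearEquiv.conj_apply_apply, hD, LinearMap.BilinForm.toDual_def, hadj, ← LinearMap.BilinForm.toDual_def (b := hB), LinearEquiv.apply_symm_apply,
      Module.Dual.transpose_apply, LinearMap.comp_apply]
  rw [← LinearMap.trace_conj' T D, hconj, LinearMap.trace_transpose']

omit [Fintype ι] [DecidableEq ι] in
/-- **`Tr(*_H S *_H) = Tr S`** (`Tr(AB) = Tr(BA)`, `*_H² = 1`). [cite: Andre1996Motifs, Prop. 3.3 (p. 21)] -/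
theorem trace_andreHodgeInvolution_mul_mul_andreHodgeInvolution (hη : ∀ v : E, v ≠ 0 → ∃ w : E, η ![v, w] ≠ 0) (d : ℕ) (S : Module.End ℂ (GForm E ℂ)) :
    LinearMap.trace ℂ (GForm E ℂ) ((hasLefschetzProperty_lefschetzG hη).andreHodgeInvolution isZGrading_countingG d * S *
        (hasLefschetzProperty_lefschetzG hη).andreHodgeInvolution isZGrading_countingG d) = LinearMap.trace ℂ (GForm E ℂ) S := by
  rw [LinearMap.trace_mul_comm, ← mul_assoc, (hasLefschetzProperty_lefschetzG hη).andreHodgeInvolution_mul_self isZGrading_countingG d, one_mul]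

/-- **`Tr u′ = Tr u`** for `u′ = *_H ᵗu *_H`. [cite: Andre1996Motifs, Prop. 3.3 (p. 21)] [cite: BourbakiAlgebraI1989, Ch. II §4 no. 3] -/
theorem trace_andreAdjoint (e : Fin N ≃ ι) {T Tt : Module.End ℂ (GForm E ℂ)}
    (hadj : LinearMap.IsAdjointPair (poincarePairingG Φ e) (poincarePairingG Φ e) T Tt) :
    LinearMap.trace ℂ (GForm E ℂ) ((hasLefschetzProperty_lefschetzG hη).andreHodgeInvolution isZGrading_countingG (finrank ℂ E) * Tt *
        (hasLefschetzProperty_lefschetzG hη).andreHodgeInvolution isZGrading_countingG (finrank ℂ E)) = LinearMap.trace ℂ (GForm E ℂ) T := by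
  rw [trace_andreHodgeInvolution_mul_mul_andreHodgeInvolution hη, trace_eq_of_isAdjointPair_poincarePairingG Φ e hadj]

/-- **THE TRACE FORM IS SYMMETRIC: `Tr(u v′) = Tr(v u′)`** for `u` with Poincaré transpose `ᵗu` and `v` with Poincaré transpose `ᵗv` commuting with `C` (`u′ = *_H ᵗu *_H`):
`ᵗ(u v′) = ᵗ(v′) ᵗu = *_H v *_H ᵗu`, so `Tr(u v′) = Tr(ᵗ(u v′)) = Tr(*_H v *_H ᵗu) = Tr(v *_H ᵗu *_H)` — André's "forme bilinéaire symétrique `(u, v) ↦ Tr(u *_H ᵗv *_H)`".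
[cite: Andre1996Motifs, Prop. 3.3 (p. 21)] [cite: Kleiman1968AlgebraicCycles, §3 Thm. 3.11] -/
theorem trace_mul_andreAdjoint_comm (e : Fin N ≃ ι) {S St T Tt : Module.End ℂ (GForm E ℂ)}
    (hS : LinearMap.IsAdjointPair (poincarePairingG Φ e) (poincarePairingG Φ e) S St) (hT : LinearMap.IsAdjointPair (poincarePairingG Φ e) (poincarePairingG Φ e) T Tt)
    (hC : Commute (rotG E (Real.pi / 2)) T) :
    LinearMap.trace ℂ (GForm E ℂ) (S * ((hasLefschetzProperty_lefschetzG hη).andreHodgeInvolution isZGrading_countingG (finrank ℂ E) * Tt *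
        (hasLefschetzProperty_lefschetzG hη).andreHodgeInvolution isZGrading_countingG (finrank ℂ E))) =
      LinearMap.trace ℂ (GForm E ℂ) (T * ((hasLefschetzProperty_lefschetzG hη).andreHodgeInvolution isZGrading_countingG (finrank ℂ E) * St *
        (hasLefschetzProperty_lefschetzG hη).andreHodgeInvolution isZGrading_countingG (finrank ℂ E))) := by
  set s := (hasLefschetzProperty_lefschetzG hη).andreHodgeInvolution isZGrading_countingG (finrank ℂ E)
  have h := trace_eq_of_isAdjointPair_poincarePairingG Φ e (hS.mul (isAdjointPair_poincarePairingG_andreAdjoint Φ hη e hT hC))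
  rw [← h, mul_assoc (s * T) s St, mul_assoc s T (s * St), LinearMap.trace_mul_comm, mul_assoc T (s * St) s]

/-- **`\overline{Tr(u v′)} = Tr(v u′)`** for real `u`, `v` commuting with the Weil operator (`η` a Kähler datum, `e : Fin (2g) ≃ ι`): the `⟨ , ⟩_H`-adjoint of `u v′` is `v u′`
(row g52-#2) and `\overline{Tr A} = Tr A*`. [cite: Andre1996Motifs, Prop. 3.3 (p. 21)] [cite: HornJohnson2013, (0.2.5)] -/
theorem conj_trace_mul_andreAdjoint (h11 : ∀ u v : E, η ![Complex.I • u, Complex.I • v] = η ![u, v]) (hpos : ∀ u : E, u ≠ 0 → 0 < η ![Complex.I • u, u])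
    (hη : ∀ v : E, v ≠ 0 → ∃ w : E, η ![v, w] ≠ 0) {g : ℕ} (e : Fin (2 * g) ≃ ι) {S St T Tt : Module.End ℂ (GForm E ℂ)}
    (hS : LinearMap.IsAdjointPair (poincarePairingG Φ e) (poincarePairingG Φ e) S St) (hSC : Commute (rotG E (Real.pi / 2)) S)
    (hSr : ∀ x, GForm.conjG (S x) = S (GForm.conjG x))
    (hT : LinearMap.IsAdjointPair (poincarePairingG Φ e) (poincarePairingG Φ e) T Tt) (hTC : Commute (rotG E (Real.pi / 2)) T)
    (hTr : ∀ x, GForm.conjG (T x) = T (GForm.conjG x)) :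
    starRingEnd ℂ (LinearMap.trace ℂ (GForm E ℂ) (S * ((hasLefschetzProperty_lefschetzG hη).andreHodgeInvolution isZGrading_countingG (finrank ℂ E) * Tt *
        (hasLefschetzProperty_lefschetzG hη).andreHodgeInvolution isZGrading_countingG (finrank ℂ E)))) =
      LinearMap.trace ℂ (GForm E ℂ) (T * ((hasLefschetzProperty_lefschetzG hη).andreHodgeInvolution isZGrading_countingG (finrank ℂ E) * St *
        (hasLefschetzProperty_lefschetzG hη).andreHodgeInvolution isZGrading_countingG (finrank ℂ E))) :=
  conj_trace_eq_trace_of_adjoint₅₆ (andreHodgeCore Φ h11 hpos hη e) fun x y ↦ by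
    rw [andreHodgeCore_inner, andreHodgeCore_inner, Module.End.mul_apply T, Module.End.mul_apply S, ← andreHodgeMetric_andreAdjoint_right Φ h11 hpos hη e hT hTC hTr,
      andreHodgeMetric_andreAdjoint_left Φ hη e hS hSC hSr]

/-- **`Tr(u v′) ∈ ℝ`: `\overline{Tr(u v′)} = Tr(u v′)`** for real `u`, `v` commuting with the Weil operator (`η` a Kähler datum) — the trace form is REAL-valued (André: "à valeurs dans
`ℚ`" on motivated correspondences; here the reality on all of `End H•(X; ℝ) ∩ {C}'`). [cite: Andre1996Motifs, Prop. 3.3 (p. 21)] -/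
theorem conj_trace_mul_andreAdjoint_self (h11 : ∀ u v : E, η ![Complex.I • u, Complex.I • v] = η ![u, v]) (hpos : ∀ u : E, u ≠ 0 → 0 < η ![Complex.I • u, u])
    (hη : ∀ v : E, v ≠ 0 → ∃ w : E, η ![v, w] ≠ 0) {g : ℕ} (e : Fin (2 * g) ≃ ι) {S St T Tt : Module.End ℂ (GForm E ℂ)}
    (hS : LinearMap.IsAdjointPair (poincarePairingG Φ e) (poincarePairingG Φ e) S St) (hSC : Commute (rotG E (Real.pi / 2)) S)
    (hSr : ∀ x, GForm.conjG (S x) = S (GForm.conjG x))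
    (hT : LinearMap.IsAdjointPair (poincarePairingG Φ e) (poincarePairingG Φ e) T Tt) (hTC : Commute (rotG E (Real.pi / 2)) T)
    (hTr : ∀ x, GForm.conjG (T x) = T (GForm.conjG x)) :
    starRingEnd ℂ (LinearMap.trace ℂ (GForm E ℂ) (S * ((hasLefschetzProperty_lefschetzG hη).andreHodgeInvolution isZGrading_countingG (finrank ℂ E) * Tt *
        (hasLefschetzProperty_lefschetzG hη).andreHodgeInvolution isZGrading_countingG (finrank ℂ E)))) =
      LinearMap.trace ℂ (GForm E ℂ) (S * ((hasLefschetzProperty_lefschetzG hη).andreHodgeInvolution isZGrading_countingG (finrank ℂ E) * Tt *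
        (hasLefschetzProperty_lefschetzG hη).andreHodgeInvolution isZGrading_countingG (finrank ℂ E))) := by
  rw [conj_trace_mul_andreAdjoint Φ h11 hpos hη e hS hSC hSr hT hTC hTr, trace_mul_andreAdjoint_comm Φ hη e hT hS hSC]

end Traces

end ComplexTorus

end Literature.Geometry.Kaehler
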